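/-
Copyright (c) 2026 the pub-hodgecm-mathlib formalisation cell (harness21).  Prover seat hodgecm-mathlib-K2E1-p16 (g2), Track B «K2-LIT» ENGINE E1, h413 = `stmt-HodgeConjecture-24833`,
route `HCCMUnconditional`, R90-S8 «ContSpec-n½» #2∕#3 chain, deal S8-R161 (1) (S8 dealer R90-CS-plan (g3)): (L3) OF LETTERS — the pole data of ★ p863403 at the middle pole from
PER-COORDINATE simple-pole data of the continued scattering coordinates (and from the Euler factorisation through the ONE scalar), BY NAME.
-/
import Mathlib.Analysis.Analytic.Constructions
import Mathlib.Analysis.Complex.Basic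
import HarnessLib

/-!
# h413 ∕ R90-S8 (L3) of letters — `K2E1ChiPoleDataAtThreeHalvesOfScalarRoadCMThree`: THE POLE DATA `hd hdw hβB` (and `hreal` off the self-associate case) OF ★ p863403 FROM
# PER-COORDINATE SIMPLE-POLE DATA OF THE CONTINUED COORDINATES

Cell `pub/hodgecm-mathlib`, crux H413 = `stmt-HodgeConjecture-24833`; S8 dealer R90-CS-plan (g3) S8-R161 (1); census on the bus 00:2xZ (a)(b)(c).  THEOREMS ONLY (no `def`, no `instance`,
no notation, no named-fact hypothesis, no `sorry`); lane `--supports stmt-HodgeConjecture-24833 --as helper` (count-neutral).  PURE bookkeeping at a point `z₀ : ℂ` (consumer: `z₀ = 3∕2`).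

THE MATHEMATICS ([MoeglinWaldspurger1995, IV.1.10–IV.1.11, IV.3.12 (a)]; [Rogawski1990, §13.9]).  After ★ (L2) (p863497 ∕ p863516 ∕ p863532) the continued scalars of the `hr2` chain are
`wc z = (Σ_j qc_j(z)·G_j)·[η]` and `Bc z z = κ·Σ_{j,l} qc_j(z)·conj qc_l(z)·G_{jl}` (finite sums of continued scattering coordinates).  ★ p863403 wants at `z₀ = 3∕2`: (hd∕hdw) an analytic
`d` with `d = (z − z₀)·wc` near `z₀`; (hβB) `|z − z₀|²·‖Bc z z‖` bounded near `z₀`; (hreal) `wc` real on the axis near `z₀`.  GIVEN per-coordinate simple-pole data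
`d_j` analytic at `z₀` with `d_j = (z − z₀)·qc_j` on a punctured neighbourhood:
* §1 **`exists_analytic_mul_wc_of_coords`** — `d := (Σ_j d_j·G_j)·[η]` pays (hd∕hdw);
* §2 **`exists_bound_normSq_mul_kernel_of_coords`** — `|z−z₀|²·Bc z z = κ·ΣΣ d_j·conj d_l·G_{jl}` (the factor `(z−z₀)·conj(z−z₀)` splits over the sesquilinear double sum), bounded near
  `z₀` by continuity of the `d_j`: pays (hβB) — NO positivity of the Gram matrix is used (★ p862829 needs the bound only);
* §3 **`poleData_of_bracket_eq_zero`** — NON-SELF-ASSOCIATE χ (`[η] = 0`): `wc ≡ 0`, so (hd∕hdw) with `d := 0` AND (hreal) are free;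
* §4 **`coords_poleData_of_factorisation`** — EULER ROUTE: if `qc_j = qc·r_j` near `z₀` with `r_j` analytic at `z₀` and ONE scalar datum `d₀ = (z − z₀)·qc` analytic (★ F5
  `exists_residue_at_threeHalves_cm_three`'s currency), then `d_j := d₀·r_j` are per-coordinate data for §1–§2.
WHAT STAYS A LETTER: (hreal) for SELF-ASSOCIATE χ — the adjoint functional equation `M(x̄) = M(x)*` read through the Gram constants [MW IV.1.10]; the per-coordinate data themselves
(Euler route ∕ (V)-assembly scalar road J-S8-SCAL).
HONEST LABEL: HC_CM is proved only modulo the 7 printed citations (2 remaining named inputs: hLiu418 = `stmt-HodgeConjecture-24832`, h413 = `stmt-HodgeConjecture-24833`) until rung 0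
closes; this file asserts no named fact and closes no socket; count-neutral.

## References
* [MoeglinWaldspurger1995] C. Mœglin, J.-L. Waldspurger, *Spectral decomposition and Eisenstein series* (1995), IV.1.10–IV.1.11, IV.3.12 (a).
* [Rogawski1990] J. D. Rogawski, *Automorphic Representations of Unitary Groups in Three Variables* (1990), §13.9.
-/

set_option autoImplicit false
-- the mandated namespace repeats `HodgeConjecture.HodgeConjecture`, as in every `Theorems/*.lean` of this sub-problem
set_option linter.dupNamespace false

noncomputable section

open Set Filter Topology
open scoped ComplexConjugate

namespace Summit.HodgeConjecture.HodgeConjecture.Cruxes.H413.K2E1ChiPoleDataAtThreeHalvesOfScalarRoadCMThree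

variable {ι : Type} [Fintype ι] {qc d : ι → ℂ → ℂ} {z₀ : ℂ}

/-! ## §1 (hd∕hdw): `(z − z₀)·wc` extends analytically across `z₀` -/

/-- **(hd∕hdw) OF ★ p863403 FROM PER-COORDINATE DATA**: if `d_j` is analytic at `z₀` with `d_j = (z − z₀)·qc_j` on a punctured neighbourhood, and `wc z = (Σ_j qc_j(z)·G_j)·Cη`, then
`d := (Σ_j d_j·G_j)·Cη` is analytic at `z₀` and `d = (z − z₀)·wc` near `z₀`. [cite: MoeglinWaldspurger1995, IV.1.11] -/
theorem exists_analytic_mul_wc_of_coords (hda : ∀ j, AnalyticAt ℂ (d j) z₀) (hdq : ∀ j, ∀ᶠ z in 𝓝[≠] z₀, d j z = (z - z₀) * qc j z)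
    (G : ι → ℂ) (Cη : ℂ) {wc : ℂ → ℂ} (hwc : ∀ z, wc z = (∑ j, qc j z * G j) * Cη) :
    ∃ D : ℂ → ℂ, AnalyticAt ℂ D z₀ ∧ ∀ᶠ z in 𝓝[≠] z₀, D z = (z - z₀) * wc z := by
  refine ⟨fun z => (∑ j, d j z * G j) * Cη, (Finset.analyticAt_fun_sum Finset.univ fun j _ => (hda j).mul analyticAt_const).mul analyticAt_const, ?_⟩
  filter_upwards [eventually_all.2 hdq] with z hz
  rw [hwc z, Finset.sum_mul, Finset.sum_mul, Finset.mul_sum]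
  exact Finset.sum_congr rfl fun j _ => by rw [hz j]; ring

/-! ## §2 (hβB): `|z − z₀|²·‖Bc z z‖` is bounded near `z₀` -/

/-- **(hβB) OF ★ p863403 FROM PER-COORDINATE DATA**: with `Bc z z = κ·Σ_{j,l} qc_j(z)·conj qc_l(z)·G_{jl}` and `d_j = (z − z₀)·qc_j` analytic at `z₀`,
`|z − z₀|²·‖Bc z z‖ = ‖κ·ΣΣ d_j(z)·conj d_l(z)·G_{jl}‖ ≤ ‖κ‖·ΣΣ M²·‖G_{jl}‖` on a punctured neighbourhood (`M` a common local bound of the `d_j`). [cite: MoeglinWaldspurger1995, IV.3.12 (a)] -/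
theorem exists_bound_normSq_mul_kernel_of_coords (hda : ∀ j, AnalyticAt ℂ (d j) z₀) (hdq : ∀ j, ∀ᶠ z in 𝓝[≠] z₀, d j z = (z - z₀) * qc j z)
    (G2 : ι → ι → ℂ) (κ : ℂ) {Bc : ℂ → ℂ → ℂ} (hBc : ∀ z, Bc z z = κ * ∑ j, ∑ l, qc j z * conj (qc l z) * G2 j l) :
    ∃ B : ℝ, ∀ᶠ z in 𝓝[≠] z₀, ‖z - z₀‖ ^ 2 * ‖Bc z z‖ ≤ B := by
  -- a common local bound `M` of the `d_j`
  set M : ℝ := ∑ j, (‖d j z₀‖ + 1) with hM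
  have hM0 : 0 ≤ M := Finset.sum_nonneg fun j _ => by positivity
  have hbd : ∀ j, ∀ᶠ z in 𝓝 z₀, ‖d j z‖ ≤ M := fun j => by
    have hc : ContinuousAt (d j) z₀ := (hda j).continuousAt
    have h1 : ∀ᶠ z in 𝓝 z₀, dist (d j z) (d j z₀) < 1 := hc.eventually (Metric.ball_mem_nhds _ one_pos)
    filter_upwards [h1] with z hz
    have h2 : ‖d j z‖ ≤ ‖d j z₀‖ + 1 := by
      have := norm_sub_norm_le (d j z) (d j z₀)
      rw [← dist_eq_norm] at this
      linarith
    exact h2.trans (Finset.single_le_sum (f := fun j => ‖d j z₀‖ + 1) (fun i _ => by positivity) (Finset.mem_univ j))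
  refine ⟨‖κ‖ * ∑ j, ∑ l, M * M * ‖G2 j l‖, ?_⟩
  have hbd' : ∀ᶠ z in 𝓝[≠] z₀, ∀ j, ‖d j z‖ ≤ M := nhdsWithin_le_nhds (eventually_all.2 hbd)
  filter_upwards [eventually_all.2 hdq, hbd'] with z hz hb
  -- `|z − z₀|²·Bc z z = κ·ΣΣ d_j conj d_l G_{jl}`
  have hsq : ‖z - z₀‖ ^ 2 * ‖Bc z z‖ = ‖(z - z₀) * conj (z - z₀) * Bc z z‖ := by
    rw [norm_mul, norm_mul, RCLike.norm_conj, sq]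
  have halg : (z - z₀) * conj (z - z₀) * Bc z z = κ * ∑ j, ∑ l, d j z * conj (d l z) * G2 j l := by
    rw [hBc z]
    simp only [Finset.mul_sum, hz, map_mul]
    exact Finset.sum_congr rfl fun j _ => Finset.sum_congr rfl fun l _ => by ring
  rw [hsq, halg, norm_mul]
  refine mul_le_mul_of_nonneg_left ?_ (norm_nonneg _)
  refine (norm_sum_le _ _).trans (Finset.sum_le_sum fun j _ => (norm_sum_le _ _).trans (Finset.sum_le_sum fun l _ => ?_))
  rw [norm_mul, norm_mul, RCLike.norm_conj]
  have hj := hb j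
  have hl := hb l
  gcongr

/-! ## §3 Non-self-associate χ: `[η] = 0`, all `w`-letters are free -/

/-- **NON-SELF-ASSOCIATE CASE** (`Cη = [η] = 0`, the cross brackets vanish — ★ `bracket_character_eq_zero`): `wc ≡ 0`, hence (hd∕hdw) hold with `d := 0` and (hreal) holds everywhere.
[cite: MoeglinWaldspurger1995, IV.1.10] [cite: Rogawski1990, §13.9] -/
theorem poleData_of_bracket_eq_zero (G : ι → ℂ) {Cη : ℂ} (hCη : Cη = 0) {wc : ℂ → ℂ} (hwc : ∀ z, wc z = (∑ j, qc j z * G j) * Cη) :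
    (∃ D : ℂ → ℂ, AnalyticAt ℂ D z₀ ∧ ∀ᶠ z in 𝓝[≠] z₀, D z = (z - z₀) * wc z) ∧ (∀ x : ℝ, (wc (x : ℂ)).im = 0) ∧
      ∀ r : ℝ, ∀ᶠ x : ℝ in 𝓝[≠] r, (wc (x : ℂ)).im = 0 := by
  have h0 : ∀ z, wc z = 0 := fun z => by rw [hwc z, hCη, mul_zero]
  exact ⟨⟨fun _ => 0, analyticAt_const, Eventually.of_forall fun z => by rw [h0 z, mul_zero]⟩, fun x => by rw [h0]; rfl,
    fun r => Eventually.of_forall fun x => by rw [h0]; rfl⟩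

/-! ## §4 Euler route: per-coordinate data from the ONE scalar -/

omit [Fintype ι] in
/-- **EULER FACTORISATION ⇒ PER-COORDINATE POLE DATA**: if near `z₀` each continued coordinate factors as `qc_j = qc·r_j` with `r_j` analytic at `z₀` (normalised local intertwiner
coefficients) and the ONE scalar has the simple-pole datum `d₀` analytic at `z₀` with `d₀ = (z − z₀)·qc` on a punctured neighbourhood (★ F5's currency at `z₀ = 3∕2`), then
`d_j := d₀·r_j` are the per-coordinate data of §1–§2. [cite: MoeglinWaldspurger1995, IV.1.11] [cite: Rogawski1990, §13.9] -/
theorem coords_poleData_of_factorisation {qcs d₀ : ℂ → ℂ} {r : ι → ℂ → ℂ} (hr : ∀ j, AnalyticAt ℂ (r j) z₀) (hd₀ : AnalyticAt ℂ d₀ z₀)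
    (hd₀q : ∀ᶠ z in 𝓝[≠] z₀, d₀ z = (z - z₀) * qcs z) (hfac : ∀ j, ∀ᶠ z in 𝓝[≠] z₀, qc j z = qcs z * r j z) :
    (∀ j, AnalyticAt ℂ (fun z => d₀ z * r j z) z₀) ∧ ∀ j, ∀ᶠ z in 𝓝[≠] z₀, (fun z => d₀ z * r j z) z = (z - z₀) * qc j z := by
  refine ⟨fun j => hd₀.mul (hr j), fun j => ?_⟩
  filter_upwards [hd₀q, hfac j] with z h0 hf
  rw [h0, hf, mul_assoc]

end Summit.HodgeConjecture.HodgeConjecture.Cruxes.H413.K2E1ChiPoleDataAtThreeHalvesOfScalarRoadCMThree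

end
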